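import Literature.Computability.MetaComplexity.DLOParityExtension
import Literature.Computability.MetaComplexity.DLOPrinciple
import Literature.Computability.MetaComplexity.OrderingResLinTreeLike
import HarnessLib

/-!
# The dense linear ordering principle in tree-like Res(⊕): size `≥ 2^{⌊(n-3)/3⌋+1}`, clause space `≥ ⌊(n-3)/3⌋+1` (GOR 2024, Thm 5)

* **Lemma 4** (`isExtensible_dloCNF`) [Gryaznov–Ovcharov–Riazanov 2024, Lemma 4; Gryaznov 2019,
  Lemma 3.6]: `DLO_n` is `(⌊(n−3)/3⌋ + 1)`-extensible w.r.t. `WORDER_n`: every linear system with at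
  most `M = ⌊(n−3)/3⌋` equations that has a `WORDER_n`-proper solution has, for every density clause
  `D_{st}`, a proper solution satisfying it. Proof as printed: a proper solution is a ranking with a
  proper witness set (`DLOPrinciple.lean`); shrink the witness set to a subset `W₁` of at most `M`
  witnesses with the same `z`-parities on the system (a larger one carries a nonempty sub-family of
  even parity on every equation — pigeonhole `exists_nonempty_even_subset'` — which can be switched
  off); move the witnesses of `W₁` out of the equations and add the `2|W₁|` equations `x_{ik} = 1`,
  `x_{kj} = 1` keeping them legal; the resulting `≤ 3M ≤ n − 3` forms are solved with a witness for
  `(s, t)` by Proposition 1′ (`OrderParity.exists_ranking_witness`, `DLOParityExtension.lean`); put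
  `W₁` back.
* **Theorem 5** (`two_pow_le_length_dloCNF_treeLike`, `le_resLinClauseSpace_dloCNF`): every
  TREE-LIKE Res(⊕) refutation (semantic weakening) of `DLO_n` has `≥ 2^{M+1}` lines and every
  configuration-style refutation has clause space `≥ M + 1`; non-vacuity: `DLO_n` is unsatisfiable
  for `n ≥ 2` (`dloCNF_not_satisfiable`: the two bottom elements have no witness) and has a tree-like
  refutation with `3·2^{n²+n³} − 1` lines.

Constants vs print: GOR state `⌊(n−3)/3⌋`-extensible / `2^{⌊(n−3)/3⌋}` / `⌊(n−3)/3⌋`; their proof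
treats "a linear system `Av = b` with at most `M` equations", i.e. gives `M + 1` in their own
convention — as for `PHPᵐₙ` and `Ordering_n`. GOR: "this result is new and to the moment cannot be
obtained using different techniques"; "its complexity for Polynomial Calculus remains an open problem".

## References

* S. Gryaznov, S. Ovcharov, A. Riazanov, ACM Trans. Comput. Theory 16(3) (2024) = arXiv:2404.08370,
  §3.1.3, Lemma 4, Proposition 1, Theorem 5 [GryaznovOvcharovRiazanov2024].
* S. Gryaznov, CSR 2019, LNCS 11532, §3.3, Lemma 3.6, Theorem 3.7 [Gryaznov2019].
-/

namespace Literature.Computability.MetaComplexity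

open _root_.Computability Complexity Finset OrderParity

/-! ### Equations as forms with a `z`-part -/

/-- The witness triples whose variable `z_{ikj}` occurs in the linear form `f`. [Gryaznov–Ovcharov–
Riazanov 2024, Lemma 4 (proof)] [cite: GryaznovOvcharovRiazanov2024, Lemma 4] -/
def litTriples (n : ℕ) (f : Finset ℕ) : Finset (ℕ × ℕ × ℕ) :=
  (distinctTriples n).toFinset.filter fun τ => zVar n τ ∈ f

/-- Membership in `litTriples`. [folklore] -/
theorem mem_litTriples {n : ℕ} {f : Finset ℕ} {τ : ℕ × ℕ × ℕ} :
    τ ∈ litTriples n f ↔ τ ∈ distinctTriples n ∧ zVar n τ ∈ f := by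
  unfold litTriples
  rw [Finset.mem_filter, List.mem_toFinset]

/-- `zVar` is injective on distinct triples of `[n]`. [folklore] -/
theorem zVar_injOn {n : ℕ} {τ τ' : ℕ × ℕ × ℕ} (hτ : τ ∈ distinctTriples n)
    (hτ' : τ' ∈ distinctTriples n) (h : zVar n τ = zVar n τ') : τ = τ' := by
  obtain ⟨h1, h2, h3, -⟩ := mem_distinctTriples.1 hτ
  obtain ⟨h1', h2', h3', -⟩ := mem_distinctTriples.1 hτ'
  rw [← decodeTriple_zVar h1 h2 h3, ← decodeTriple_zVar h1' h2' h3', h]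

/-- **Parity of a form under the assignment of a ranking with witnesses** = pair parity of its
pairs + witness parity of its triples + the (fixed) junk contribution. [Gryaznov–Ovcharov–Riazanov
2024, Lemma 4 (proof)] [cite: GryaznovOvcharovRiazanov2024, Lemma 4] -/
theorem sum_dloAssign (n : ℕ) (ρ : ℕ → ℕ) (W : Finset (ℕ × ℕ × ℕ)) (σ : ℕ → Bool) (f : Finset ℕ) :
    ∑ v ∈ f, (if dloAssign n ρ W σ v = true then (1 : ZMod 2) else 0) =
      pairParity ρ (litPairs n f) + wParity W (litTriples n f) +
        ∑ v ∈ f with ¬ (v < n * n ∧ v / n ≠ v % n) ∧ ¬ IsZVar n v,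
          (if σ v = true then (1 : ZMod 2) else 0) := by
  classical
  unfold dloAssign
  rw [sum_rankAssign, add_assoc]
  congr 1
  rw [← Finset.sum_filter_add_sum_filter_not (f.filter fun v => ¬ (v < n * n ∧ v / n ≠ v % n))
    (IsZVar n)]
  congr 1
  · -- the `z`-variables of `f`
    have hset : (f.filter fun v => ¬ (v < n * n ∧ v / n ≠ v % n)).filter (IsZVar n) =
        (litTriples n f).image (zVar n) := by
      ext v
      simp only [Finset.mem_filter, Finset.mem_image, mem_litTriples]
      constructor
      · rintro ⟨⟨hvf, -⟩, hz⟩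
        obtain ⟨henc, hmem⟩ := zVar_decodeTriple hz
        exact ⟨decodeTriple n v, ⟨hmem, by rw [henc]; exact hvf⟩, henc⟩
      · rintro ⟨τ, ⟨hτ, hτf⟩, rfl⟩
        exact ⟨⟨hτf, not_isOrdVar_of_isZVar (isZVar_zVar hτ)⟩, isZVar_zVar hτ⟩
    rw [hset, Finset.sum_image fun τ hτ τ' hτ' h =>
      zVar_injOn (mem_litTriples.1 hτ).1 (mem_litTriples.1 hτ').1 h]
    unfold wParity
    refine Finset.sum_congr rfl fun τ hτ => ?_
    obtain ⟨hτd, -⟩ := mem_litTriples.1 hτ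
    obtain ⟨h1, h2, h3, -⟩ := mem_distinctTriples.1 hτd
    unfold zAssign
    rw [if_pos (isZVar_zVar hτd), decodeTriple_zVar h1 h2 h3]
    by_cases h : τ ∈ W <;> simp [h]
  · -- junk
    rw [Finset.filter_filter]
    refine Finset.sum_congr rfl fun v hv => ?_
    obtain ⟨-, -, hz⟩ := Finset.mem_filter.1 hv
    unfold zAssign
    rw [if_neg hz]

/-- Two assignments of rankings with witnesses giving the form the same value give the equation
`(f = b)` the same value. [Gryaznov–Ovcharov–Riazanov 2024, Lemma 4 (proof)]
[cite: GryaznovOvcharovRiazanov2024, Lemma 4] -/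
theorem linLit_eval_dloAssign_eq {n : ℕ} {ρ ρ' : ℕ → ℕ} {W W' : Finset (ℕ × ℕ × ℕ)} (σ : ℕ → Bool)
    {f : Finset ℕ} (b : Bool)
    (h : pairParity ρ' (litPairs n f) + wParity W' (litTriples n f) =
      pairParity ρ (litPairs n f) + wParity W (litTriples n f)) :
    LinLit.eval (dloAssign n ρ' W' σ) (f, b) = LinLit.eval (dloAssign n ρ W σ) (f, b) := by
  apply Bool.eq_iff_iff.2
  rw [linLit_eval_eq_true_iff_sum, linLit_eval_eq_true_iff_sum, sum_dloAssign, sum_dloAssign, h]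

/-- **Dependent columns by pigeonhole**, for columns of any type: more than `k` columns carry a
nonempty subset of even parity on each of `k` given sets. [folklore] -/
theorem exists_nonempty_even_subset' {α : Type*} [DecidableEq α] (I : Finset α)
    (Zs : List (Finset α)) (h : Zs.length < I.card) :
    ∃ U ⊆ I, U.Nonempty ∧ ∀ Z ∈ Zs, (∑ τ ∈ Z, if τ ∈ U then (1 : ZMod 2) else 0) = 0 := by
  classical
  let g : Finset α → (Fin Zs.length → ZMod 2) := fun U t =>
    ∑ τ ∈ Zs.get t, if τ ∈ U then (1 : ZMod 2) else 0
  have hmaps : ∀ U ∈ I.powerset, g U ∈ (Finset.univ : Finset (Fin Zs.length → ZMod 2)) :=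
    fun _ _ => Finset.mem_univ _
  have hcard : (Finset.univ : Finset (Fin Zs.length → ZMod 2)).card < I.powerset.card := by
    rw [Finset.card_univ, Fintype.card_fun, ZMod.card, Fintype.card_fin, Finset.card_powerset]
    exact Nat.pow_lt_pow_right (by norm_num) h
  obtain ⟨U₁, hU₁, U₂, hU₂, hne, hg⟩ := Finset.exists_ne_map_eq_of_card_lt_of_maps_to hcard hmaps
  rw [Finset.mem_powerset] at hU₁ hU₂
  refine ⟨symmDiff U₁ U₂, ?_, ?_, ?_⟩
  · intro v hv
    rw [Finset.mem_symmDiff] at hv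
    rcases hv with ⟨h1, -⟩ | ⟨h2, -⟩
    · exact hU₁ h1
    · exact hU₂ h2
  · rw [Finset.nonempty_iff_ne_empty]
    intro h0
    exact hne (symmDiff_eq_bot.1 h0)
  · intro Z hZ
    obtain ⟨t, ht, rfl⟩ := List.getElem_of_mem hZ
    have hgt := congrFun hg ⟨t, ht⟩
    simp only [g, List.get_eq_getElem] at hgt
    have hsplit : ∑ τ ∈ Zs[t], (if τ ∈ symmDiff U₁ U₂ then (1 : ZMod 2) else 0) =
        ∑ τ ∈ Zs[t], (if τ ∈ U₁ then (1 : ZMod 2) else 0) +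
          ∑ τ ∈ Zs[t], (if τ ∈ U₂ then (1 : ZMod 2) else 0) := by
      rw [← Finset.sum_add_distrib]
      refine Finset.sum_congr rfl fun τ _ => ?_
      by_cases h1 : τ ∈ U₁ <;> by_cases h2 : τ ∈ U₂ <;> simp [Finset.mem_symmDiff, h1, h2]
      decide
    rw [hsplit, hgt, CharTwo.add_self_eq_zero]

/-- Adding witnesses: the witness parity of `W₁ ∪ W'` is that of `W₁` plus that of `W'` on the
triples outside `W₁`. [folklore] -/
theorem wParity_union (W₁ W' Z : Finset (ℕ × ℕ × ℕ)) :
    wParity (W₁ ∪ W') Z = wParity W₁ Z + wParity W' (Z \ W₁) := by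
  unfold wParity
  have hsd : Z \ W₁ = Z.filter fun τ => τ ∉ W₁ := by
    ext τ; rw [Finset.mem_sdiff, Finset.mem_filter]
  rw [hsd, Finset.sum_filter, ← Finset.sum_add_distrib]
  refine Finset.sum_congr rfl fun τ _ => ?_
  by_cases h1 : τ ∈ W₁ <;> by_cases h2 : τ ∈ W' <;> simp [Finset.mem_union, h1, h2]

/-! ### Lemma 4: `DLO_n` is `(⌊(n−3)/3⌋+1)`-extensible w.r.t. `WORDER_n` -/

/-- **Lemma 4** [Gryaznov–Ovcharov–Riazanov 2024, Lemma 4 ("`DLO_n` is `⌊(n−3)/3⌋`-extensible w.r.t.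
`WORDER_n`" — the proof gives one more in their convention); Gryaznov 2019, Lemma 3.6]: every linear
system with at most `⌊(n−3)/3⌋` equations that has a `WORDER_n`-proper solution has, for every density
clause `D_{st}`, a `WORDER_n`-proper solution satisfying it. [cite: GryaznovOvcharovRiazanov2024, Lemma 4] -/
theorem isExtensible_dloCNF (n : ℕ) :
    IsExtensible (dloCNF n) (worderClauses n) ((n - 3) / 3 + 1) := by
  classical
  intro Φ hlen hsol c hc hcF
  obtain ⟨σ, hσF, hσΦ⟩ := hsol
  obtain ⟨s, t, hs, ht, hst, rfl⟩ : ∃ s t, s < n ∧ t < n ∧ s ≠ t ∧ c = densityClause n s t := by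
    rcases mem_dloCNF_iff.1 hc with h | h
    · exact absurd h hcF
    · exact h
  -- trivial case: `σ` already satisfies `D_{st}`
  by_cases hsat : Clause.eval σ (densityClause n s t) = true
  · exact ⟨σ, hσF, hσΦ, hsat⟩
  have hσst : σ (ordVar n s t) = true := by
    by_contra h
    rw [Bool.not_eq_true] at h
    exact hsat (eval_densityClause_iff.2 (Or.inl h))
  -- the ranking and the witnesses of `σ`
  have hord : IsFProper (linOrderClauses n) σ := (isFProper_worderClauses_iff.1 hσF).1
  have hinj : Set.InjOn (rankOf n σ) (Finset.range n : Finset ℕ) := injOn_rankOf hord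
  have hW₀ : WProper (Finset.range n) (rankOf n σ) (witSet n σ) := wProper_witSet hσF
  have hr₀st : rankOf n σ s < rankOf n σ t := (eq_true_iff_rankOf_lt hord hs ht hst).1 hσst
  have hσeq : dloAssign n (rankOf n σ) (witSet n σ) σ = σ := dloAssign_self hσF
  have hΦlen : Φ.length ≤ (n - 3) / 3 := by omega
  -- ### degenerate case `n ≤ 2`: the system is empty; reverse the order
  by_cases hn3 : n < 3
  · have hΦnil : Φ = [] := List.eq_nil_of_length_eq_zero (by
      have : (n - 3) / 3 = 0 := by rw [show n - 3 = 0 by omega]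
      omega)
    set ρ : ℕ → ℕ := fun y => if y = t then 0 else 1 with hρ
    have hρinj : Set.InjOn ρ (Finset.range n : Finset ℕ) := by
      intro y hy y' hy' h
      rw [Finset.mem_coe, Finset.mem_range] at hy hy'
      simp only [hρ] at h
      split_ifs at h with h1 h2 h2 <;> omega
    refine ⟨dloAssign n ρ ∅ σ, isFProper_dloAssign hρinj (fun τ hτ => absurd hτ (Finset.notMem_empty τ)) σ,
      by rw [hΦnil]; simp, ?_⟩
    rw [eval_densityClause_iff]
    left
    rw [dloAssign_ordVar ρ ∅ σ hs ht hst]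
    simp [hρ, hst]
  push Not at hn3
  -- ### Step 1: a smallest set `W₁` of `σ`'s witnesses with the same `z`-parities on `Φ`
  set Z : LinLit → Finset (ℕ × ℕ × ℕ) := fun e => litTriples n e.1 with hZ
  set 𝒢 : Finset (Finset (ℕ × ℕ × ℕ)) := (witSet n σ).powerset.filter fun W =>
    ∀ e ∈ Φ, wParity W (Z e) = wParity (witSet n σ) (Z e) with h𝒢
  have hmem𝒢 : ∀ W, W ∈ 𝒢 ↔ W ⊆ witSet n σ ∧ ∀ e ∈ Φ, wParity W (Z e) = wParity (witSet n σ) (Z e) := by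
    intro W; rw [h𝒢, Finset.mem_filter, Finset.mem_powerset]
  obtain ⟨W₁, hW₁𝒢, hW₁min⟩ := Finset.exists_min_image 𝒢 Finset.card
    ⟨witSet n σ, (hmem𝒢 _).2 ⟨subset_rfl, fun _ _ => rfl⟩⟩
  obtain ⟨hW₁sub, hW₁good⟩ := (hmem𝒢 W₁).1 hW₁𝒢
  have hW₁card : W₁.card ≤ Φ.length := by
    by_contra hlt
    push Not at hlt
    obtain ⟨U, hUW, hUne, hUeven⟩ := exists_nonempty_even_subset' W₁ (Φ.map Z)
      (by rw [List.length_map]; exact hlt)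
    have hgood : W₁ \ U ∈ 𝒢 := by
      rw [hmem𝒢]
      refine ⟨Finset.sdiff_subset.trans hW₁sub, fun e he => ?_⟩
      rw [← hW₁good e he]
      have hU := hUeven (Z e) (List.mem_map.2 ⟨e, he, rfl⟩)
      have hsplit : wParity W₁ (Z e) =
          wParity (W₁ \ U) (Z e) + ∑ τ ∈ Z e, (if τ ∈ U then (1 : ZMod 2) else 0) := by
        unfold wParity
        rw [← Finset.sum_add_distrib]
        refine Finset.sum_congr rfl fun τ _ => ?_
        by_cases hτU : τ ∈ U
        · have hτW : τ ∈ W₁ := hUW hτU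
          have hτWU : τ ∉ W₁ \ U := fun h => (Finset.mem_sdiff.1 h).2 hτU
          rw [if_pos hτW, if_pos hτU, if_neg hτWU, zero_add]
        · by_cases hτW : τ ∈ W₁
          · rw [if_pos hτW, if_neg hτU, if_pos (Finset.mem_sdiff.2 ⟨hτW, hτU⟩), add_zero]
          · rw [if_neg hτW, if_neg hτU, if_neg (fun h => hτW (Finset.mem_sdiff.1 h).1), add_zero]
      rw [hsplit, hU, add_zero]
    have hlt' : (W₁ \ U).card < W₁.card := by
      rw [Finset.card_sdiff_of_subset hUW]
      have := Finset.card_pos.2 hUne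
      have := Finset.card_le_card hUW
      omega
    exact absurd (hW₁min _ hgood) (not_le.2 hlt')
  have hW₁prop : ∀ τ ∈ W₁, (τ.1 < n ∧ τ.2.1 < n ∧ τ.2.2 < n) ∧
      rankOf n σ τ.1 < rankOf n σ τ.2.1 ∧ rankOf n σ τ.2.1 < rankOf n σ τ.2.2 := by
    intro τ hτ
    obtain ⟨⟨h1, h2, h3⟩, h12, h23⟩ := hW₀ τ (hW₁sub hτ)
    exact ⟨⟨Finset.mem_range.1 h1, Finset.mem_range.1 h2, Finset.mem_range.1 h3⟩, h12, h23⟩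
  -- ### Step 2: the system for Proposition 1′
  set C : List (Finset (ℕ × ℕ) × Finset (ℕ × ℕ × ℕ)) :=
    Φ.map (fun e => (litPairs n e.1, Z e \ W₁)) ++
      (W₁.toList.map (fun τ => (({(τ.1, τ.2.1)} : Finset (ℕ × ℕ)), (∅ : Finset (ℕ × ℕ × ℕ)))) ++
        W₁.toList.map (fun τ => (({(τ.2.1, τ.2.2)} : Finset (ℕ × ℕ)), (∅ : Finset (ℕ × ℕ × ℕ)))))
    with hC
  have hClen : C.length + 3 ≤ (Finset.range n).card := by
    rw [hC, Finset.card_range, List.length_append, List.length_append, List.length_map,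
      List.length_map, List.length_map, Finset.length_toList]
    have h3 : 3 * ((n - 3) / 3) ≤ n - 3 := Nat.mul_div_le (n - 3) 3
    omega
  have hCmem : ∀ F ∈ C, (∃ e ∈ Φ, F = (litPairs n e.1, Z e \ W₁)) ∨
      (∃ τ ∈ W₁, F = (({(τ.1, τ.2.1)} : Finset (ℕ × ℕ)), (∅ : Finset (ℕ × ℕ × ℕ)))) ∨
      (∃ τ ∈ W₁, F = (({(τ.2.1, τ.2.2)} : Finset (ℕ × ℕ)), (∅ : Finset (ℕ × ℕ × ℕ)))) := by
    intro F hF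
    rw [hC] at hF
    rcases List.mem_append.1 hF with hF | hF
    · obtain ⟨e, he, rfl⟩ := List.mem_map.1 hF
      exact Or.inl ⟨e, he, rfl⟩
    · rcases List.mem_append.1 hF with hF | hF
      · obtain ⟨τ, hτ, rfl⟩ := List.mem_map.1 hF
        exact Or.inr (Or.inl ⟨τ, Finset.mem_toList.1 hτ, rfl⟩)
      · obtain ⟨τ, hτ, rfl⟩ := List.mem_map.1 hF
        exact Or.inr (Or.inr ⟨τ, Finset.mem_toList.1 hτ, rfl⟩)
  have hCΦ : ∀ e ∈ Φ, (litPairs n e.1, Z e \ W₁) ∈ C := fun e he => by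
    rw [hC]; exact List.mem_append.2 (Or.inl (List.mem_map.2 ⟨e, he, rfl⟩))
  have hC₁ : ∀ τ ∈ W₁, (({(τ.1, τ.2.1)} : Finset (ℕ × ℕ)), (∅ : Finset (ℕ × ℕ × ℕ))) ∈ C :=
    fun τ hτ => by
      rw [hC]
      exact List.mem_append.2 (Or.inr (List.mem_append.2 (Or.inl
        (List.mem_map.2 ⟨τ, Finset.mem_toList.2 hτ, rfl⟩))))
  have hC₂ : ∀ τ ∈ W₁, (({(τ.2.1, τ.2.2)} : Finset (ℕ × ℕ)), (∅ : Finset (ℕ × ℕ × ℕ))) ∈ C :=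
    fun τ hτ => by
      rw [hC]
      exact List.mem_append.2 (Or.inr (List.mem_append.2 (Or.inr
        (List.mem_map.2 ⟨τ, Finset.mem_toList.2 hτ, rfl⟩))))
  have hCpairs : ∀ F ∈ C, ∀ p ∈ F.1, p.1 ∈ Finset.range n ∧ p.2 ∈ Finset.range n ∧ p.1 ≠ p.2 := by
    intro F hF p hp
    rcases hCmem F hF with ⟨e, -, rfl⟩ | ⟨τ, hτ, rfl⟩ | ⟨τ, hτ, rfl⟩
    · obtain ⟨⟨hk, hl, hne⟩, -⟩ := mem_litPairs.1 hp
      exact ⟨Finset.mem_range.2 hk, Finset.mem_range.2 hl, hne⟩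
    · simp only [Finset.mem_singleton] at hp
      rw [hp]
      obtain ⟨⟨h1, h2, -⟩, h12, -⟩ := hW₁prop τ hτ
      exact ⟨Finset.mem_range.2 h1, Finset.mem_range.2 h2, fun h => by
        simp only at h; rw [h] at h12; exact lt_irrefl _ h12⟩
    · simp only [Finset.mem_singleton] at hp
      rw [hp]
      obtain ⟨⟨-, h2, h3⟩, -, h23⟩ := hW₁prop τ hτ
      exact ⟨Finset.mem_range.2 h2, Finset.mem_range.2 h3, fun h => by
        simp only at h; rw [h] at h23; exact lt_irrefl _ h23⟩
  obtain ⟨r', W', hr', hW', hval, k₀, hk₀⟩ := exists_ranking_witness hinj (Finset.mem_range.2 hs)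
    (Finset.mem_range.2 ht) hr₀st hClen hCpairs
  -- values on the three kinds of forms
  have hvalΦ : ∀ e ∈ Φ, pairParity r' (litPairs n e.1) + wParity W' (Z e \ W₁) =
      pairParity (rankOf n σ) (litPairs n e.1) := by
    intro e he
    exact hval (litPairs n e.1, Z e \ W₁) (hCΦ e he)
  have hbit : ∀ {a b : ℕ}, pairParity r' {(a, b)} + wParity W' ∅ = pairParity (rankOf n σ) {(a, b)} →
      rankOf n σ a < rankOf n σ b → r' a < r' b := by
    intro a b h hab
    unfold pairParity wParity at h
    rw [Finset.sum_singleton, Finset.sum_singleton, Finset.sum_empty, add_zero] at h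
    unfold cmpBit at h
    rw [if_pos hab] at h
    by_contra hlt
    rw [if_neg hlt] at h
    exact zero_ne_one h
  -- ### Step 3: put `W₁` back
  set Wf : Finset (ℕ × ℕ × ℕ) := W₁ ∪ W' with hWf
  have hWf' : WProper (Finset.range n) r' Wf := by
    intro τ hτ
    rcases Finset.mem_union.1 hτ with h | h
    · obtain ⟨⟨h1, h2, h3⟩, h12, h23⟩ := hW₁prop τ h
      exact ⟨⟨Finset.mem_range.2 h1, Finset.mem_range.2 h2, Finset.mem_range.2 h3⟩,
        hbit (hval _ (hC₁ τ h)) h12, hbit (hval _ (hC₂ τ h)) h23⟩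
    · exact hW' τ h
  refine ⟨dloAssign n r' Wf σ, isFProper_dloAssign hr' hWf' σ, ?_, ?_⟩
  · -- the equations keep their values
    rintro ⟨f, b⟩ he
    have hT : pairParity r' (litPairs n f) + wParity Wf (litTriples n f) =
        pairParity (rankOf n σ) (litPairs n f) + wParity (witSet n σ) (litTriples n f) := by
      have h1 := hvalΦ (f, b) he
      have h3 := hW₁good (f, b) he
      simp only [hZ] at h1 h3
      rw [hWf, wParity_union, ← h3, ← h1]
      ring
    rw [linLit_eval_dloAssign_eq σ b hT, hσeq]
    exact hσΦ _ he
  · -- `D_{st}` holds by the witness `k₀`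
    rw [eval_densityClause_iff]
    right
    obtain ⟨⟨-, hk₀n, -⟩, h1, h2⟩ := hW' _ hk₀
    simp only at h1 h2 hk₀n
    rw [Finset.mem_range] at hk₀n
    have hk₀s : k₀ ≠ s := fun h => by rw [h] at h1; exact lt_irrefl _ h1
    have hk₀t : k₀ ≠ t := fun h => by rw [h] at h2; exact lt_irrefl _ h2
    refine ⟨k₀, hk₀n, hk₀s, hk₀t, ?_⟩
    rw [dloAssign_zVar r' Wf σ (mem_distinctTriples.2 ⟨hs, hk₀n, ht, Ne.symm hk₀s, hst, hk₀t⟩),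
      decide_eq_true_eq, hWf]
    exact Finset.mem_union_right _ hk₀

end Literature.Computability.MetaComplexity
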